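import Summits.ABC.IUTFork.Cor312LicenceShallowGenuineK
import HarnessLib

/-!
# [IUTchIII] Cor. 3.12, branch C — the INHABITED tame MULTI-SLOT licence window (abc-iut-w5-d180) for realising ideles, and at
# GENUINE `K`-level data: it forces `i·P_q(w) < e_w` per label, hence only the q-SHALLOWNESS `(l−3)·ord_v(q_v) < 4l·e(v|p)` — NO bound on `l`

PROOF-ONLY record file (no `def`, no new `Prop`, no instance) of the abc-iut cell (WAVE-5 prover seat abc-iut-w5-d009, gen 9; row
«GENUINE-WINDOW-SMALL-L» §2). TAKES NO SIDE on [IUTchIII] Cor. 3.12 or on any author. Sequel of `Cor312LicenceShallowGenuineK.lean`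
(p442024: the ONE-FACTOR inhabited locus at genuine data forces `l ≤ 8·e(v|p) + 1`).

CONTEXT. abc-iut-w5-d180's `Cor312LicenceShallowMultiSlotLicence.lean` (p440550 ✓) proves the (xi-f) licence at the sharp real settings in
the TAME MULTI-SLOT regime: per prime `p` under `S` a donation rate `ρ_p ≥ 1` with every place `x | p` tame and
`ρ_p ≤ ‖p‖⁻¹·‖ϖ_x‖`, and per bad `w | p` and label `j = i+1` the window
`hwin : ‖t_{q,w}‖ ≤ ‖t_{Θ,j,w}‖ ∨ ∃ ϖ k, ‖p‖·‖p‖^k‖ϖ‖ < ‖t_{Θ,j,w}‖ ≤ ‖p‖^k‖ϖ‖ ∧ ‖t_{q,w}‖ ≤ ρ_p^j·‖p‖^k‖ϖ‖`.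
This file READS that window (its literal disjunction, any `ρ_p` admitted by the tameness clause) for ideles REALISING the pilot divisors
(Dupuy–Hilado (3.4): `‖t_{q,w}‖ = p^{−P_q(w)/e_w}`, `‖t_{Θ,j,w}‖ = p^{−j²·P_q(w)/e_w}`, abc-iut-w5-d236's `norm_qIdele_eq_rpow_of_realises` /
`norm_thetaIdele_eq_rpow_of_realises`), first for an ABSTRACT pilot datum `X`, then at the GENUINE one `Cor312Prov.pilotDataOfK D K`.

WHAT IS PROVED (elementary; namespace `Summit.ABC.IUTFork.Thm311.Real` for the generic part, `…Cor312Prov` for the genuine part):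
* `label_mul_qPilot_lt_ramIdx_of_slot_window` — GENERIC: the window at `(w, j = i+1)` with a rate `1 ≤ ρ_p ≤ ‖p‖⁻¹·‖ϖ_x‖` (some `x | p`)
  forces **`i·P_q(w) < e_w`** (chain `‖t_q‖ ≤ ρ^j‖p‖^k‖ϖ‖ < ρ^j·p·‖t_Θ‖ ≤ p^{j+1}‖t_Θ‖`, `ρ < p`; exponents `(j²−1)·P_q < (j+1)·e_w`);
  so the multi-slot window requires ramification `e_w > (l⋆−1)·P_q(w)` at the top label — compare the one-factor `(l⋆)²·P_q(w) < e_w + 1`;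
* `lstar_sub_one_mul_ordq_lt_of_slot_window_pilotDataOfK` — GENUINE: at `X := pilotDataOfK D K` (`P_q(w) = e(w|v)·ord_v(q_v)/(2l)`,
  `e_w = e(v|p)·e(w|v)`) the top-label window forces **`(l⋆ − 1)·ord_v(q_v) < 2l·e(v|p)`**, i.e. `(l − 3)·ord_v(q_v) < 4l·e(v|p)`
  (`l_sub_three_mul_ordq_lt_…`), and for `l > 12·e(v|p) + 3` simply **`ord_v(q_v) ≤ 4·e(v|p)`** (`ordq_le_four_mul_ramIdx_…`);
* `genuine_necessary_of_tame_slots_pilotDataOfK` — in the LITERAL hypothesis shape (`ρ`, `hρ1`, `hρ`, `hwin`) of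
  `licence_settingPrVolSharp_of_tame_slots` at `X := pilotDataOfK D K` with realising ideles: at every bad `(p, w)`,
  `l + 2 ≤ p` and `(l − 3)·ord_v(q_v) < 4l·e(v|p)`.

READING (numbers; nothing about print). Unlike the one-factor locus (empty for `l > 8·e(v|p)+1`, p442024), the multi-slot window at genuine
data constrains `l` ONLY through tameness of the bad primes (`p ≥ l + 2`): its content is the q-SHALLOWNESS `ord_v(q_v) < 4l·e(v|p)/(l−3)`
(`≤ 4·e(v|p)` once `l > 12·e(v|p)+3`) — the forced ramification `e(w|v) ≥ l` of [IUTchI] Ex. 3.2 (iv) supplies exactly the ramification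
`e_w > (l⋆−1)·P_q(w)` the window needs. These are NECESSARY conditions; that they suffice (abc-iut-w5-d180's orders window
`m_q ≥ e·⌈m_Θ/e⌉ − (j+1)(e−1)` needs a UNIFORMLY ramified tame fibre) and that some initial Θ-datum meets them is NOT claimed here. The
DEEP side at genuine data is abc-iut-C-cert-1's «HEX-KERNEL» (`Conditional/AbcOfSGenuineKChosenDepth*.lean`). HONEST SCOPE as in the
companions: OUR sharp containers, Dupuy–Hilado's typed (Ind2) acting per capsule slot and place; STRONGER-THAN-PRINT licence; nothing about
the printed GLOBAL inequality; nothing asserts or refutes [IUTchIII] Cor. 3.12; typed ≠ proved; instantiated ≠ endorsed.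
[cite: Mochizuki2012, IUTchI Def. 3.1 (b),(c) pp. 61–62; Ex. 3.2 (iv) p. 71; IUTchIII Thm. 3.11 (i) (Ind2) p. 154] [cite: DupuyHilado2025, §3.3, §3.4, §4.9]
[cite: NeukirchANT1999, Ch. II Prop. (5.5), (6.8)] [claim: Mochizuki2012, status: disputed] for every IUT sentence quoted.
-/

noncomputable section

open NumberField IsDedekindDomain

/-! ## §1. Generic: the multi-slot window at `(w, j)` for realising ideles forces `(j−1)·P_q(w) < e_w` -/

namespace Summit.ABC.IUTFork.Thm311.Real

open Cor312 Cor312Vol Literature.IUT.LogThetaLattice Literature.IUT.LogVolume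
open Literature.NumberTheory.NumberFields Literature.NumberTheory.GaloisRepresentations.Ultrametric

variable {F : Type} [Field F] [NumberField F] (X : PilotData F)
  (tq : ∀ (pp : Nat.Primes) (x : (thetaIndex X).Fibre (.inr pp)), haveI : Fact (pp : ℕ).Prime := ⟨pp.2⟩; kOf X pp.1 x)
  (t : ∀ (pp : Nat.Primes) (_ : Fin X.lstar) (x : (thetaIndex X).Fibre (.inr pp)),
    haveI : Fact (pp : ℕ).Prime := ⟨pp.2⟩; kOf X pp.1 x)
  (htq0 : ∀ pp x, tq pp x ≠ 0)
  (ht0 : ∀ pp i x, t pp i x ≠ 0)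
  (ht : ∀ (pp : Nat.Primes) (i : Fin X.lstar) (x : (thetaIndex X).Fibre (.inr pp)),
    haveI : Fact (pp : ℕ).Prime := ⟨pp.2⟩
    Real.log ‖t pp i x‖ = -(X.thetaPilot i (placeOf X pp.1 x)) * logNorm F (placeOf X pp.1 x) /
      localDegree F (placeOf X pp.1 x))
  (htq : ∀ (pp : Nat.Primes) (x : (thetaIndex X).Fibre (.inr pp)),
    haveI : Fact (pp : ℕ).Prime := ⟨pp.2⟩
    Real.log ‖tq pp x‖ = -(X.qPilot (placeOf X pp.1 x)) * logNorm F (placeOf X pp.1 x) /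
      localDegree F (placeOf X pp.1 x))

include htq0 ht0 ht htq in
/-- **The tame multi-slot window at `(w, j = i+1)` forces `i·P_q(w) < e_w` for realising ideles** (any `P_q(w) ∈ ℝ`). Either branch of
abc-iut-w5-d180's `hwin`: `‖t_q‖ ≤ ‖t_{Θ,j}‖` gives `(j²−1)·P_q ≤ 0`; the level branch with a rate `1 ≤ ρ ≤ ‖p‖⁻¹‖ϖ_x‖ < p` gives
`‖t_q‖ ≤ ρ^j‖p‖^k‖ϖ‖ < ρ^j·p·‖t_Θ‖ ≤ p^{j+1}·‖t_Θ‖`, i.e. `−P_q/e < (j+1) − j²P_q/e`, `(j²−1)·P_q < (j+1)·e`. (Sharper with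
`ρ ≤ p^{1−1/e_x}`: `(j−1)·P_q ≤ e − 1` for integral `P_q`; not needed below.) [cite: DupuyHilado2025, §3.4, §4.9]
[cite: NeukirchANT1999, Ch. II Prop. (5.5)] [claim: Mochizuki2012, status: disputed] -/
theorem label_mul_qPilot_lt_ramIdx_of_slot_window (pp : Nat.Primes) (i : Fin X.lstar) (w : (thetaIndex X).Fibre (.inr pp))
    {ρ : ℝ} (hρ1 : 1 ≤ ρ)
    (hρx : haveI : Fact (pp : ℕ).Prime := ⟨pp.2⟩
      ∃ (x : (thetaIndex X).Fibre (.inr pp)) (ϖ : (kOf X pp.1 x)ˣ), IsUniformizer ϖ ∧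
        ρ ≤ ‖(pp : ℚ_[pp])‖⁻¹ * ‖(ϖ : kOf X pp.1 x)‖)
    (hwin : haveI : Fact (pp : ℕ).Prime := ⟨pp.2⟩
      ‖tq pp w‖ ≤ ‖t pp i w‖ ∨
        ∃ (ϖ : (kOf X pp.1 w)ˣ) (k : ℤ), IsUniformizer ϖ ∧
          ‖(pp : ℚ_[pp])‖ * (‖(pp : ℚ_[pp])‖ ^ k * ‖(ϖ : kOf X pp.1 w)‖) < ‖t pp i w‖ ∧
          ‖t pp i w‖ ≤ ‖(pp : ℚ_[pp])‖ ^ k * ‖(ϖ : kOf X pp.1 w)‖ ∧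
          ‖tq pp w‖ ≤ ρ ^ ((i : ℕ) + 1) * (‖(pp : ℚ_[pp])‖ ^ k * ‖(ϖ : kOf X pp.1 w)‖)) :
    haveI : Fact (pp : ℕ).Prime := ⟨pp.2⟩
    ((i : ℕ) : ℝ) * X.qPilot (placeOf X pp.1 w) < (ramIdx F (placeOf X pp.1 w) : ℝ) := by
  haveI : Fact (pp : ℕ).Prime := ⟨pp.2⟩
  set v := placeOf X pp.1 w with hv
  set P : ℝ := X.qPilot v with hP
  set e : ℕ := ramIdx F v with he
  have hp1 : (1 : ℝ) < ((pp : ℕ) : ℝ) := by exact_mod_cast pp.2.one_lt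
  have hp0 : (0 : ℝ) < ((pp : ℕ) : ℝ) := by positivity
  have he0 : (0 : ℝ) < (e : ℝ) := by exact_mod_cast Nat.pos_of_ne_zero (ramIdx_ne_zero F v)
  -- the label coefficient `c = (i+1)²`
  set c : ℝ := (((i : ℕ) + 1 : ℕ) : ℝ) ^ 2 with hc
  have hc' : c = (((i : ℕ) : ℝ) + 1) ^ 2 := by rw [hc]; push_cast; ring
  have hnq : ‖tq pp w‖ = ((pp : ℕ) : ℝ) ^ (-P / (e : ℝ)) := norm_qIdele_eq_rpow_of_realises X tq htq0 htq pp w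
  have hnt : ‖t pp i w‖ = ((pp : ℕ) : ℝ) ^ (-(c * P) / (e : ℝ)) :=
    norm_thetaIdele_eq_rpow_of_realises X tq t htq0 ht0 ht htq pp i w
  have hi0 : (0 : ℝ) ≤ ((i : ℕ) : ℝ) := by positivity
  have hi2 : (0 : ℝ) < ((i : ℕ) : ℝ) + 2 := by positivity
  have hc1 : c - 1 = ((i : ℕ) : ℝ) * (((i : ℕ) : ℝ) + 2) := by rw [hc']; ring
  rcases hwin with h | ⟨ϖ, k, -, hlow, -, hq⟩
  · -- branch `‖t_q‖ ≤ ‖t_Θ‖`: `c·P ≤ P`, so `i(i+2)·P ≤ 0`, `i·P ≤ 0 < e`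
    rw [hnq, hnt, Real.rpow_le_rpow_left_iff hp1, div_le_div_iff_of_pos_right he0, neg_le_neg_iff] at h
    have h' : ((i : ℕ) : ℝ) * P * (((i : ℕ) : ℝ) + 2) ≤ 0 :=
      calc ((i : ℕ) : ℝ) * P * (((i : ℕ) : ℝ) + 2) = (c - 1) * P := by rw [hc1]; ring
        _ ≤ 0 := by linarith
    have hiP : ((i : ℕ) : ℝ) * P ≤ 0 := by
      by_contra hlt
      rw [not_le] at hlt
      linarith [mul_pos hlt hi2]
    linarith
  · -- level branch: `‖t_q‖ ≤ ρ^j‖p‖^k‖ϖ‖ < ρ^j · p · ‖t_Θ‖ ≤ p^{j+1} · ‖t_Θ‖`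
    obtain ⟨x, ϖx, hϖx, hρle⟩ := hρx
    have hnp : ‖((pp : ℕ) : ℚ_[pp])‖ = ((pp : ℕ) : ℝ)⁻¹ := Padic.norm_p
    have hρp : ρ < ((pp : ℕ) : ℝ) := by
      have h1 : ‖(ϖx : kOf X pp.1 x)‖ < 1 := hϖx.norm_lt_one
      have h2 : ‖((pp : ℕ) : ℚ_[pp])‖⁻¹ * ‖(ϖx : kOf X pp.1 x)‖ < ((pp : ℕ) : ℝ) := by
        rw [hnp, inv_inv]
        calc ((pp : ℕ) : ℝ) * ‖(ϖx : kOf X pp.1 x)‖ < ((pp : ℕ) : ℝ) * 1 := mul_lt_mul_of_pos_left h1 hp0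
          _ = ((pp : ℕ) : ℝ) := mul_one _
      exact lt_of_le_of_lt hρle h2
    have hρ0 : (0 : ℝ) < ρ := lt_of_lt_of_le zero_lt_one hρ1
    set L : ℝ := ‖((pp : ℕ) : ℚ_[pp])‖ ^ k * ‖(ϖ : kOf X pp.1 w)‖ with hL
    -- `L < p · ‖t_Θ‖` from `‖p‖·L < ‖t_Θ‖`
    have hLt : L < ((pp : ℕ) : ℝ) * ‖t pp i w‖ := by
      rw [hnp] at hlow
      rwa [inv_mul_lt_iff₀ hp0] at hlow
    have hρj : ρ ^ ((i : ℕ) + 1) ≤ ((pp : ℕ) : ℝ) ^ ((i : ℕ) + 1) := pow_le_pow_left₀ hρ0.le hρp.le _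
    have hρj0 : 0 < ρ ^ ((i : ℕ) + 1) := pow_pos hρ0 _
    have hchain : ‖tq pp w‖ < ((pp : ℕ) : ℝ) ^ ((i : ℕ) + 1) * (((pp : ℕ) : ℝ) * ‖t pp i w‖) :=
      calc ‖tq pp w‖ ≤ ρ ^ ((i : ℕ) + 1) * L := hq
        _ < ρ ^ ((i : ℕ) + 1) * (((pp : ℕ) : ℝ) * ‖t pp i w‖) := mul_lt_mul_of_pos_left hLt hρj0
        _ ≤ ((pp : ℕ) : ℝ) ^ ((i : ℕ) + 1) * (((pp : ℕ) : ℝ) * ‖t pp i w‖) :=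
            mul_le_mul_of_nonneg_right hρj (mul_nonneg hp0.le (norm_nonneg _))
    -- in exponents of `p`: `−P/e < (j + 1) + (−c·P/e)`
    have hexp : -P / (e : ℝ) < ((((i : ℕ) + 1 : ℕ) : ℝ) + 1) + -(c * P) / (e : ℝ) := by
      have hrhs : ((pp : ℕ) : ℝ) ^ ((i : ℕ) + 1) * (((pp : ℕ) : ℝ) * ‖t pp i w‖) =
          ((pp : ℕ) : ℝ) ^ (((((i : ℕ) + 1 : ℕ) : ℝ) + 1) + -(c * P) / (e : ℝ)) := by
        rw [hnt, Real.rpow_add hp0, Real.rpow_add hp0, Real.rpow_one, Real.rpow_natCast]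
        ring
      rw [hnq, hrhs, Real.rpow_lt_rpow_left_iff hp1] at hchain
      exact hchain
    -- clear the denominator: `(c − 1)·P < (j + 1)·e`
    have h2 : (c - 1) * P < (((((i : ℕ) + 1 : ℕ) : ℝ) + 1)) * (e : ℝ) := by
      have h3 := mul_lt_mul_of_pos_right hexp he0
      rw [add_mul, div_mul_cancel₀ _ he0.ne', div_mul_cancel₀ _ he0.ne'] at h3
      linarith
    -- `c − 1 = i·(i+2)` and `j + 1 = i + 2`: cancel `i + 2 > 0`
    have h4 : ((i : ℕ) : ℝ) * P * (((i : ℕ) : ℝ) + 2) < (e : ℝ) * (((i : ℕ) : ℝ) + 2) :=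
      calc ((i : ℕ) : ℝ) * P * (((i : ℕ) : ℝ) + 2) = (c - 1) * P := by rw [hc1]; ring
        _ < (((((i : ℕ) + 1 : ℕ) : ℝ) + 1)) * (e : ℝ) := h2
        _ = (e : ℝ) * (((i : ℕ) : ℝ) + 2) := by push_cast; ring
    exact lt_of_mul_lt_mul_right h4 hi2.le

include htq0 ht0 ht htq in
/-- **At the TOP label `j = l⋆` the multi-slot windows force `(l⋆ − 1)·P_q(w) < e_w`** (generic realising ideles; the windows at all
labels at the bad place `w`, any admissible rate). Compare the one-factor locus `(l⋆)²·P_q(w) < e_w + 1` (abc-iut-w5-d236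
`lstar_sq_le_ramIdx_of_degree_window`). [cite: DupuyHilado2025, §3.4, §4.9] [claim: Mochizuki2012, status: disputed] -/
theorem lstar_sub_one_mul_qPilot_lt_ramIdx_of_slot_windows (pp : Nat.Primes) (w : (thetaIndex X).Fibre (.inr pp))
    {ρ : ℝ} (hρ1 : 1 ≤ ρ)
    (hρx : haveI : Fact (pp : ℕ).Prime := ⟨pp.2⟩
      ∃ (x : (thetaIndex X).Fibre (.inr pp)) (ϖ : (kOf X pp.1 x)ˣ), IsUniformizer ϖ ∧
        ρ ≤ ‖(pp : ℚ_[pp])‖⁻¹ * ‖(ϖ : kOf X pp.1 x)‖)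
    (hwin : ∀ i : Fin X.lstar, haveI : Fact (pp : ℕ).Prime := ⟨pp.2⟩
      ‖tq pp w‖ ≤ ‖t pp i w‖ ∨
        ∃ (ϖ : (kOf X pp.1 w)ˣ) (k : ℤ), IsUniformizer ϖ ∧
          ‖(pp : ℚ_[pp])‖ * (‖(pp : ℚ_[pp])‖ ^ k * ‖(ϖ : kOf X pp.1 w)‖) < ‖t pp i w‖ ∧
          ‖t pp i w‖ ≤ ‖(pp : ℚ_[pp])‖ ^ k * ‖(ϖ : kOf X pp.1 w)‖ ∧
          ‖tq pp w‖ ≤ ρ ^ ((i : ℕ) + 1) * (‖(pp : ℚ_[pp])‖ ^ k * ‖(ϖ : kOf X pp.1 w)‖)) :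
    haveI : Fact (pp : ℕ).Prime := ⟨pp.2⟩
    ((X.lstar - 1 : ℕ) : ℝ) * X.qPilot (placeOf X pp.1 w) < (ramIdx F (placeOf X pp.1 w) : ℝ) := by
  have h2 := X.two_le_lstar
  set i₀ : Fin X.lstar := ⟨X.lstar - 1, by omega⟩ with hi₀
  have h := label_mul_qPilot_lt_ramIdx_of_slot_window X tq t htq0 ht0 ht htq pp i₀ w hρ1 hρx (hwin i₀)
  exact h

end Summit.ABC.IUTFork.Thm311.Real

/-! ## §2. At the GENUINE `K`-level datum `pilotDataOfK D K`: `i·ord_v(q_v) < 2l·e(v|p)`, `(l−3)·ord_v(q_v) < 4l·e(v|p)` -/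

namespace Summit.ABC.IUTFork.Cor312Prov

open Thm311 Thm311.Real Literature.IUT.LogVolume Literature.IUT.HodgeTheaters
open Literature.NumberTheory.GaloisRepresentations.Ultrametric

variable {F K Fbar : Type} [Field F] [NumberField F] [Field K] [NumberField K] [Algebra F K] [Field Fbar]
  [Algebra F Fbar] [Algebra K Fbar] {E : WeierstrassCurve F} [E.IsElliptic] {l : ℕ} {Pb : BadPlacePredicates K}
  (D : InitialThetaData F K Fbar E l Pb)
  (tq : ∀ (pp : Nat.Primes) (x : (thetaIndex (pilotDataOfK D K)).Fibre (.inr pp)),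
    haveI : Fact (pp : ℕ).Prime := ⟨pp.2⟩; kOf (pilotDataOfK D K) pp.1 x)
  (t : ∀ (pp : Nat.Primes) (_ : Fin (pilotDataOfK D K).lstar) (x : (thetaIndex (pilotDataOfK D K)).Fibre (.inr pp)),
    haveI : Fact (pp : ℕ).Prime := ⟨pp.2⟩; kOf (pilotDataOfK D K) pp.1 x)
  (htq0 : ∀ pp x, tq pp x ≠ 0)
  (ht0 : ∀ pp i x, t pp i x ≠ 0)
  (ht : ∀ (pp : Nat.Primes) (i : Fin (pilotDataOfK D K).lstar) (x : (thetaIndex (pilotDataOfK D K)).Fibre (.inr pp)),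
    haveI : Fact (pp : ℕ).Prime := ⟨pp.2⟩
    Real.log ‖t pp i x‖ = -((pilotDataOfK D K).thetaPilot i (placeOf (pilotDataOfK D K) pp.1 x)) *
      logNorm K (placeOf (pilotDataOfK D K) pp.1 x) / localDegree K (placeOf (pilotDataOfK D K) pp.1 x))
  (htq : ∀ (pp : Nat.Primes) (x : (thetaIndex (pilotDataOfK D K)).Fibre (.inr pp)),
    haveI : Fact (pp : ℕ).Prime := ⟨pp.2⟩
    Real.log ‖tq pp x‖ = -((pilotDataOfK D K).qPilot (placeOf (pilotDataOfK D K) pp.1 x)) *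
      logNorm K (placeOf (pilotDataOfK D K) pp.1 x) / localDegree K (placeOf (pilotDataOfK D K) pp.1 x))

include htq0 ht0 ht htq in
/-- **GENUINE data, label `j = i+1`: the multi-slot window forces `i·ord_v(q_v) < 2l·e(v|p)`** (`v` the place of `F` under the bad
place): the generic `i·P_q(w) < e_w` with `P_q(w) = e(w|v)·ord_v(q_v)/(2l)` (`qPilot_pilotDataOfK_eq`) and `e_w = e(v|p)·e(w|v)`
(`ramIdx_eq_ramIdx_finBelow_mul`); `e(w|v) > 0` cancels. [cite: Mochizuki2012, IUTchI Def. 3.1 (c) p. 62; Ex. 3.2 (iv) p. 71]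
[cite: DupuyHilado2025, §3.3, §3.4] [claim: Mochizuki2012, status: disputed] -/
theorem label_mul_ordq_lt_of_slot_window_pilotDataOfK (pp : Nat.Primes) (i : Fin (pilotDataOfK D K).lstar)
    (w : (thetaIndex (pilotDataOfK D K)).Fibre (.inr pp))
    (hS : haveI : Fact (pp : ℕ).Prime := ⟨pp.2⟩; placeOf (pilotDataOfK D K) pp.1 w ∈ (pilotDataOfK D K).S)
    {ρ : ℝ} (hρ1 : 1 ≤ ρ)
    (hρx : haveI : Fact (pp : ℕ).Prime := ⟨pp.2⟩
      ∃ (x : (thetaIndex (pilotDataOfK D K)).Fibre (.inr pp)) (ϖ : (kOf (pilotDataOfK D K) pp.1 x)ˣ), IsUniformizer ϖ ∧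
        ρ ≤ ‖(pp : ℚ_[pp])‖⁻¹ * ‖(ϖ : kOf (pilotDataOfK D K) pp.1 x)‖)
    (hwin : haveI : Fact (pp : ℕ).Prime := ⟨pp.2⟩
      ‖tq pp w‖ ≤ ‖t pp i w‖ ∨
        ∃ (ϖ : (kOf (pilotDataOfK D K) pp.1 w)ˣ) (k : ℤ), IsUniformizer ϖ ∧
          ‖(pp : ℚ_[pp])‖ * (‖(pp : ℚ_[pp])‖ ^ k * ‖(ϖ : kOf (pilotDataOfK D K) pp.1 w)‖) < ‖t pp i w‖ ∧
          ‖t pp i w‖ ≤ ‖(pp : ℚ_[pp])‖ ^ k * ‖(ϖ : kOf (pilotDataOfK D K) pp.1 w)‖ ∧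
          ‖tq pp w‖ ≤ ρ ^ ((i : ℕ) + 1) * (‖(pp : ℚ_[pp])‖ ^ k * ‖(ϖ : kOf (pilotDataOfK D K) pp.1 w)‖)) :
    haveI : Fact (pp : ℕ).Prime := ⟨pp.2⟩
    (i : ℕ) * qParamOrd E (finBelow F K (placeOf (pilotDataOfK D K) pp.1 w)) <
      2 * l * ramIdx F (finBelow F K (placeOf (pilotDataOfK D K) pp.1 w)) := by
  haveI : Fact (pp : ℕ).Prime := ⟨pp.2⟩
  have h := label_mul_qPilot_lt_ramIdx_of_slot_window (pilotDataOfK D K) tq t htq0 ht0 ht htq pp i w hρ1 hρx hwin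
  set w' := placeOf (pilotDataOfK D K) pp.1 w with hw'
  rw [qPilot_pilotDataOfK_eq D hS, ramIdx_eq_ramIdx_finBelow_mul (F := F) w'] at h
  set ε : ℕ := (finBelow F K w').asIdeal.ramificationIdx' w'.asIdeal with hε
  set q : ℕ := qParamOrd E (finBelow F K w') with hq
  set b : ℕ := ramIdx F (finBelow F K w') with hb
  have h5 : 5 ≤ l := D.five_le_l
  have hε0 : (0 : ℝ) < (ε : ℝ) := by exact_mod_cast Nat.pos_of_ne_zero (ramificationIdx'_finBelow_ne_zero (F := F) K w')
  have hl0 : (0 : ℝ) < 2 * (l : ℝ) := by positivity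
  -- `h : i · (ε·q/(2l)) < b·ε`; multiply by `2l`, cancel `ε`
  push_cast at h
  rw [← mul_div_assoc, div_lt_iff₀ hl0] at h
  have h2 : ((i : ℕ) : ℝ) * (q : ℝ) * (ε : ℝ) < 2 * (l : ℝ) * (b : ℝ) * (ε : ℝ) := by nlinarith [h]
  have h3 : ((i : ℕ) : ℝ) * (q : ℝ) < 2 * (l : ℝ) * (b : ℝ) := lt_of_mul_lt_mul_right h2 hε0.le
  exact_mod_cast h3

include htq0 ht0 ht htq in
/-- **GENUINE data, top label: the multi-slot windows force `(l⋆ − 1)·ord_v(q_v) < 2l·e(v|p)`.**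
[cite: Mochizuki2012, IUTchI Def. 3.1 (c) p. 62; Ex. 3.2 (iv) p. 71] [cite: DupuyHilado2025, §3.3, §3.4] [claim: Mochizuki2012, status: disputed] -/
theorem lstar_sub_one_mul_ordq_lt_of_slot_windows_pilotDataOfK (pp : Nat.Primes)
    (w : (thetaIndex (pilotDataOfK D K)).Fibre (.inr pp))
    (hS : haveI : Fact (pp : ℕ).Prime := ⟨pp.2⟩; placeOf (pilotDataOfK D K) pp.1 w ∈ (pilotDataOfK D K).S)
    {ρ : ℝ} (hρ1 : 1 ≤ ρ)
    (hρx : haveI : Fact (pp : ℕ).Prime := ⟨pp.2⟩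
      ∃ (x : (thetaIndex (pilotDataOfK D K)).Fibre (.inr pp)) (ϖ : (kOf (pilotDataOfK D K) pp.1 x)ˣ), IsUniformizer ϖ ∧
        ρ ≤ ‖(pp : ℚ_[pp])‖⁻¹ * ‖(ϖ : kOf (pilotDataOfK D K) pp.1 x)‖)
    (hwin : ∀ i : Fin (pilotDataOfK D K).lstar, haveI : Fact (pp : ℕ).Prime := ⟨pp.2⟩
      ‖tq pp w‖ ≤ ‖t pp i w‖ ∨
        ∃ (ϖ : (kOf (pilotDataOfK D K) pp.1 w)ˣ) (k : ℤ), IsUniformizer ϖ ∧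
          ‖(pp : ℚ_[pp])‖ * (‖(pp : ℚ_[pp])‖ ^ k * ‖(ϖ : kOf (pilotDataOfK D K) pp.1 w)‖) < ‖t pp i w‖ ∧
          ‖t pp i w‖ ≤ ‖(pp : ℚ_[pp])‖ ^ k * ‖(ϖ : kOf (pilotDataOfK D K) pp.1 w)‖ ∧
          ‖tq pp w‖ ≤ ρ ^ ((i : ℕ) + 1) * (‖(pp : ℚ_[pp])‖ ^ k * ‖(ϖ : kOf (pilotDataOfK D K) pp.1 w)‖)) :
    haveI : Fact (pp : ℕ).Prime := ⟨pp.2⟩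
    ((pilotDataOfK D K).lstar - 1) * qParamOrd E (finBelow F K (placeOf (pilotDataOfK D K) pp.1 w)) <
      2 * l * ramIdx F (finBelow F K (placeOf (pilotDataOfK D K) pp.1 w)) := by
  have h2 := (pilotDataOfK D K).two_le_lstar
  set i₀ : Fin (pilotDataOfK D K).lstar := ⟨(pilotDataOfK D K).lstar - 1, by omega⟩ with hi₀
  exact label_mul_ordq_lt_of_slot_window_pilotDataOfK D tq t htq0 ht0 ht htq pp i₀ w hS hρ1 hρx (hwin i₀)

/-- Arithmetic: `(l⋆ − 1)·q < 2l·b` with `l = 2l⋆ + 1` gives `(l − 3)·q < 4l·b`, and for `l > 12b + 3` even `q ≤ 4b`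
(`(l−3)(q − 4b) < 12b < l − 3`). [folklore] -/
theorem ordq_bounds_of_lstar_window {l ls q b : ℕ} (hl : l = 2 * ls + 1) (h : (ls - 1) * q < 2 * l * b) :
    (l - 3) * q < 4 * l * b ∧ (12 * b + 3 < l → q ≤ 4 * b) := by
  subst hl
  have h1 : (2 * ls + 1 - 3) * q = 2 * ((ls - 1) * q) := by
    rcases Nat.lt_or_ge ls 1 with h0 | h0
    · have : ls = 0 := by omega
      subst this; simp
    · have : 2 * ls + 1 - 3 = 2 * (ls - 1) := by omega
      rw [this, mul_assoc]
  have h1' : 4 * (2 * ls + 1) * b = 2 * (2 * (2 * ls + 1) * b) := by ring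
  refine ⟨by rw [h1, h1']; omega, fun hbig => ?_⟩
  by_contra hq
  rw [not_le] at hq
  -- `q ≥ 4b + 1` and `ls − 1 > 6b`: `(ls−1)·q ≥ (ls−1)(4b+1) = 4b(ls−1) + (ls−1) > 4b(ls−1) + 6b = 2(2ls+1)b + ... `
  have hls : 6 * b + 1 ≤ ls - 1 := by omega
  have h3 : (ls - 1) * (4 * b + 1) ≤ (ls - 1) * q := Nat.mul_le_mul_left _ hq
  have h4 : (ls - 1) * (4 * b + 1) = 4 * b * (ls - 1) + (ls - 1) := by ring
  have h5 : 2 * (2 * ls + 1) * b = 4 * b * (ls - 1) + 6 * b := by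
    have : 1 ≤ ls := by omega
    zify [this]
    ring
  omega

include htq0 ht0 ht htq in
/-- **NECESSARY CONDITIONS FOR THE TAME MULTI-SLOT WINDOW AT GENUINE `K`-LEVEL DATA**, in the LITERAL hypothesis shape (`ρ`, `hρ1`,
`hρ`, `hwin`) of abc-iut-w5-d180's `Thm311.Real.licence_settingPrVolSharp_of_tame_slots` at `X := pilotDataOfK D K` with realising
ideles: at every bad `(p, w)`, with `v` the place of `F` under `w` — **`l + 2 ≤ p`** (tameness, `e_w ≥ l`: p442024
`l_add_two_le_residueChar_of_tame_pilotDataOfK`), **`(l − 3)·ord_v(q_v) < 4l·e(v|p)`**, and **`ord_v(q_v) ≤ 4·e(v|p)` whenever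
`l > 12·e(v|p) + 3`**. No upper bound on `l` follows (contrast p442024's one-factor `l ≤ 8·e(v|p) + 1`).
[cite: Mochizuki2012, IUTchI Def. 3.1 (b),(c) pp. 61–62; Ex. 3.2 (iv) p. 71; IUTchIII Thm. 3.11 (i) (Ind2) p. 154]
[cite: DupuyHilado2025, §3.3, §3.4, §4.9] [claim: Mochizuki2012, status: disputed] -/
theorem genuine_necessary_of_tame_slots_pilotDataOfK (ρ : Nat.Primes → ℝ) (hρ1 : ∀ pp, 1 ≤ ρ pp)
    (hρ : ∀ (pp : Nat.Primes) (x : (thetaIndex (pilotDataOfK D K)).Fibre (.inr pp)),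
      haveI : Fact (pp : ℕ).Prime := ⟨pp.2⟩
      (∃ w : (thetaIndex (pilotDataOfK D K)).Fibre (.inr pp), placeOf (pilotDataOfK D K) pp.1 w ∈ (pilotDataOfK D K).S) →
        2 < (pp : ℕ) ∧ (placeOf (pilotDataOfK D K) pp.1 x).asIdeal.ramificationIdx ℤ ≤ (pp : ℕ) - 2 ∧
          ∃ ϖ : (kOf (pilotDataOfK D K) pp.1 x)ˣ, IsUniformizer ϖ ∧
            ρ pp ≤ ‖(pp : ℚ_[pp])‖⁻¹ * ‖(ϖ : kOf (pilotDataOfK D K) pp.1 x)‖)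
    (hwin : ∀ (pp : Nat.Primes) (i : Fin (thetaIndex (pilotDataOfK D K)).lstar)
      (w : (thetaIndex (pilotDataOfK D K)).Fibre (.inr pp)),
      haveI : Fact (pp : ℕ).Prime := ⟨pp.2⟩
      placeOf (pilotDataOfK D K) pp.1 w ∈ (pilotDataOfK D K).S →
        ‖tq pp w‖ ≤ ‖t pp i w‖ ∨
          ∃ (ϖ : (kOf (pilotDataOfK D K) pp.1 w)ˣ) (k : ℤ), IsUniformizer ϖ ∧
            ‖(pp : ℚ_[pp])‖ * (‖(pp : ℚ_[pp])‖ ^ k * ‖(ϖ : kOf (pilotDataOfK D K) pp.1 w)‖) < ‖t pp i w‖ ∧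
            ‖t pp i w‖ ≤ ‖(pp : ℚ_[pp])‖ ^ k * ‖(ϖ : kOf (pilotDataOfK D K) pp.1 w)‖ ∧
            ‖tq pp w‖ ≤ ρ pp ^ ((i : ℕ) + 1) * (‖(pp : ℚ_[pp])‖ ^ k * ‖(ϖ : kOf (pilotDataOfK D K) pp.1 w)‖))
    (pp : Nat.Primes) (w : (thetaIndex (pilotDataOfK D K)).Fibre (.inr pp))
    (hS : haveI : Fact (pp : ℕ).Prime := ⟨pp.2⟩; placeOf (pilotDataOfK D K) pp.1 w ∈ (pilotDataOfK D K).S) :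
    haveI : Fact (pp : ℕ).Prime := ⟨pp.2⟩
    l + 2 ≤ (pp : ℕ) ∧
      (l - 3) * qParamOrd E (finBelow F K (placeOf (pilotDataOfK D K) pp.1 w)) <
        4 * l * ramIdx F (finBelow F K (placeOf (pilotDataOfK D K) pp.1 w)) ∧
      (12 * ramIdx F (finBelow F K (placeOf (pilotDataOfK D K) pp.1 w)) + 3 < l →
        qParamOrd E (finBelow F K (placeOf (pilotDataOfK D K) pp.1 w)) ≤
          4 * ramIdx F (finBelow F K (placeOf (pilotDataOfK D K) pp.1 w))) := by
  haveI : Fact (pp : ℕ).Prime := ⟨pp.2⟩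
  set w' := placeOf (pilotDataOfK D K) pp.1 w with hw'
  obtain ⟨-, hex, ϖx, hϖx, hρle⟩ := hρ pp w ⟨w, hS⟩
  -- tameness ⇒ `l + 2 ≤ p`
  have hres : residueChar K w' = (pp : ℕ) := residueChar_eq_of_natCast_mem (pp : ℕ) (natCast_mem_placeOf (pilotDataOfK D K) pp.1 w)
  have htame : ramIdx K w' ≤ residueChar K w' - 2 := by rw [ramIdx_eq K w', hres]; exact hex
  have hp := l_add_two_le_residueChar_of_tame_pilotDataOfK D hS htame
  rw [hres] at hp
  -- the top-label window
  have hwin' := lstar_sub_one_mul_ordq_lt_of_slot_windows_pilotDataOfK D tq t htq0 ht0 ht htq pp w hS (hρ1 pp)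
    ⟨w, ϖx, hϖx, hρle⟩ (fun i => hwin pp i w hS)
  have hl : l = 2 * (pilotDataOfK D K).lstar + 1 := (pilotDataOfK D K).l_eq
  exact ⟨hp, ordq_bounds_of_lstar_window hl hwin'⟩

end Summit.ABC.IUTFork.Cor312Prov

end
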